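import Literature.Geometry.Riemannian.MetricFlowFDistance
import HarnessLib

/-!
# Restricting metric flow pairs and correspondences to a smaller time set; monotonicity of the
# `𝔽`-distance (Bamler 2023, §5.1 with §3.1 (restriction) and §6.1 (convergence on sub-intervals))

R. Bamler, *Compactness theory of the space of super Ricci flows*, Invent. Math. 233 (2023): §3.1,
Definition (restriction of a metric flow to `I' ⊂ I`); §5.1, Definitions (metric flow pairs,
correspondence, 𝔽-distance within a correspondence, 𝔽-distance); §6.1, where convergence "on
compact time-intervals" is defined through the restrictions `𝒳_{I₀}`, `ℭ|_{I'' ∩ I₀}`,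
`J ∩ I₀` (Def. 6.1 / arXiv v1 Def. 124). The source uses, without stating them as lemmas, that
restricting everything to a smaller time set `I₀` (and shrinking `J`) can only DECREASE the
𝔽-distance: the same comparison spaces, embeddings, exceptional set (`E ∩ I₀`) and couplings
witness every admissible radius. We construct the restrictions (`MetricFlowPair.restrict`,
`Correspondence₂.restrict`) and prove `FDistAdmissible.restrict`, `fDistWithin_restrict_le`,
`fDist_restrict_le`, and the monotonicity in `J` (`FDistAdmissible.anti_J`, `fDistWithin_mono`,
`fDist_mono`). Everything is proved; no named facts. (`I₀` must be measurable for the restricted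
exceptional set to be measurable — the tree's Definition asks for a measurable `E`.)

## References

* R. H. Bamler, *Compactness theory of the space of super Ricci flows*, Invent. Math. 233 (2023),
  1121–1277, §3.1 Definition (restriction); §5.1 Definitions; §6.1 Def. 6.1. [Bamler2023]
-/

noncomputable section

open Set MeasureTheory Filter TopologicalSpace Function
open scoped Topology ENNReal NNReal

namespace Literature.Geometry.Riemannian

universe u

/-! ### Restriction of metric flow pairs -/

namespace MetricFlowPair

variable {I : Set ℝ}

/-- **Restriction of a metric flow pair to `I₀ ⊆ I`** (Bamler 2023, §6.1: `(𝒳_{I₀}, (μ_t)_{t ∈ I' ∩ I₀})`):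
times `I' ∩ I₀`, the restricted flow, the same measures. [cite: Bamler2023, §6.1, Def. 6.1; §3.1, Definition (restriction)] -/
def restrict (P : MetricFlowPair.{u} I) {I₀ : Set ℝ} (h₀ : I₀ ⊆ I) : MetricFlowPair.{u} I₀ where
  I' := P.I' ∩ I₀
  subset := inter_subset_right
  volume_diff := by
    refine measure_mono_null (fun t ht ↦ ?_) P.volume_diff
    exact ⟨h₀ ht.1, fun h' ↦ ht.2 ⟨h', ht.1⟩⟩
  flow := P.flow.restrict inter_subset_left
  μ := fun t ↦ P.μ ⟨t, t.2.1⟩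
  isConjugateHeatFlow := by
    refine ⟨fun t ht ↦ P.isProbabilityMeasure_μ ⟨t, t.2.1⟩, ?_⟩
    intro s t hs ht hst S hS
    exact P.isConjugateHeatFlow.2 (s := ⟨s, s.2.1⟩) (t := ⟨t, t.2.1⟩) hs.1 ht.1 hst S hS
  isOpenPosMeasure := fun t ↦ P.isOpenPosMeasure ⟨t, t.2.1⟩

/-- The times of the restriction. [cite: Bamler2023, §6.1, Def. 6.1] -/
@[simp] theorem restrict_I' (P : MetricFlowPair.{u} I) {I₀ : Set ℝ} (h₀ : I₀ ⊆ I) :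
    (P.restrict h₀).I' = P.I' ∩ I₀ := rfl

/-- A pair fully defined over `J` restricts to a pair fully defined over `J ∩ I₀`.
[cite: Bamler2023, §6.1, Def. 6.1] -/
theorem FullyDefinedOver.restrict {P : MetricFlowPair.{u} I} {J : Set ℝ} (hJ : P.FullyDefinedOver J)
    {I₀ : Set ℝ} (h₀ : I₀ ⊆ I) : (P.restrict h₀).FullyDefinedOver (J ∩ I₀) :=
  fun _ ht ↦ ⟨hJ ht.1, ht.2⟩

end MetricFlowPair

/-! ### Restriction of correspondences -/

namespace MetricFlow

namespace Correspondence₂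

variable {I₁ I₂ : Set ℝ} {𝒳₁ : MetricFlow.{u} I₁} {𝒳₂ : MetricFlow.{u} I₂} {I'' : Set ℝ}

/-- **Restriction of a correspondence** to `I₀'' ⊆ I''` between the restricted flows
`𝒳¹|_{I₁ ∩ I₀''}`, `𝒳²|_{I₂ ∩ I₀''}` (Bamler 2023, §6.1: `ℭ|_{I'' ∩ I₀}`): the same comparison
spaces and embeddings, domains intersected with `I₀''`. Here the restricted flows are presented as
`𝒳ᵢ.restrict hᵢ` for any `Iᵢ' ⊆ Iᵢ` containing the new domains (in applications
`Iᵢ' = Pᵢ.I' ∩ I₀`). [cite: Bamler2023, §6.1, Def. 6.1; §5.1, Definition (Correspondence)] -/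
def restrict (ℭ : Correspondence₂ 𝒳₁ 𝒳₂ I'') {I₀'' I₁' I₂' : Set ℝ} (h₀ : I₀'' ⊆ I'')
    (h₁ : I₁' ⊆ I₁) (h₂ : I₂' ⊆ I₂) (hd₁ : ℭ.dom₁ ∩ I₀'' ⊆ I₁') (hd₂ : ℭ.dom₂ ∩ I₀'' ⊆ I₂') :
    Correspondence₂ (𝒳₁.restrict h₁) (𝒳₂.restrict h₂) I₀'' where
  Z := fun t ↦ ℭ.Z ⟨t, h₀ t.2⟩
  dom₁ := ℭ.dom₁ ∩ I₀''
  dom₂ := ℭ.dom₂ ∩ I₀''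
  dom₁_subset := fun _ ht ↦ ⟨hd₁ ht, ht.2⟩
  dom₂_subset := fun _ ht ↦ ⟨hd₂ ht, ht.2⟩
  φ₁ := fun t ht ↦ ℭ.φ₁ t ht.1
  φ₂ := fun t ht ↦ ℭ.φ₂ t ht.1
  isometry₁ := fun t ht ↦ ℭ.isometry₁ t ht.1
  isometry₂ := fun t ht ↦ ℭ.isometry₂ t ht.1

end Correspondence₂

end MetricFlow

/-! ### Monotonicity of the `𝔽`-distance -/

namespace MetricFlowPair

open MetricFlow

variable {I₁ I₂ : Set ℝ} {P₁ : MetricFlowPair.{u} I₁} {P₂ : MetricFlowPair.{u} I₂} {I'' : Set ℝ}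
  {ℭ : Correspondence₂ P₁.flow P₂.flow I''} {J : Set ℝ}

/-- **Shrinking `J` keeps radii admissible** (the conditions on `E` and the couplings do not
mention `J` except through `J ⊆ I'' ∖ E`). [cite: Bamler2023, §5.1, Definition (F-distance within correspondence)] -/
theorem FDistAdmissible.anti_J {J' : Set ℝ} {r : ℝ} (h : FDistAdmissible P₁ P₂ ℭ J r)
    (hJ : J' ⊆ J) : FDistAdmissible P₁ P₂ ℭ J' r := by
  obtain ⟨hr, E, hEm, hEI, hJE, hE₁, hE₂, hvol, q, hq, hint⟩ := h
  exact ⟨hr, E, hEm, hEI, hJ.trans hJE, hE₁, hE₂, hvol, q, hq, hint⟩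

/-- **`d^{ℭ,J'}_𝔽 ≤ d^{ℭ,J}_𝔽` for `J' ⊆ J`.** [cite: Bamler2023, §5.1, Definition (F-distance within correspondence)] -/
theorem fDistWithin_mono {J' : Set ℝ} (hJ : J' ⊆ J) :
    fDistWithin P₁ P₂ ℭ J' ≤ fDistWithin P₁ P₂ ℭ J :=
  le_fDistWithin_iff.2 fun _ hr ↦ fDistWithin_le (hr.anti_J hJ)

/-- **`d^{J'}_𝔽 ≤ d^{J}_𝔽` for `J' ⊆ J`** (fewer times over which the correspondences must be fully
defined, and every admissible radius stays admissible). [cite: Bamler2023, §5.1, Definition (F-distance)] -/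
theorem fDist_mono {I : Set ℝ} {J J' : Set ℝ} (hJ : J' ⊆ J) (Q₁ Q₂ : MetricFlowPair.{u} I) :
    fDist J' Q₁ Q₂ ≤ fDist J Q₁ Q₂ :=
  le_iInf₂ fun ℭ hℭ ↦ (iInf₂_le ℭ ⟨hJ.trans hℭ.1, hJ.trans hℭ.2⟩).trans (fDistWithin_mono hJ)

/-- **Restriction keeps radii admissible**: if `r` is admissible for `d^{ℭ,J}_𝔽(𝒳¹, 𝒳²)` and
`I₀ ⊆ I''` is measurable, then `r` is admissible for the restricted pairs within the restricted
correspondence, uniformly over `J ∩ I₀` (exceptional set `E ∩ I₀`, the same couplings).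
[cite: Bamler2023, §6.1, Def. 6.1; §5.1, Definition (F-distance within correspondence)] -/
theorem FDistAdmissible.restrict {r : ℝ} (h : FDistAdmissible P₁ P₂ ℭ J r) {I₀ : Set ℝ}
    (hI₀ : MeasurableSet I₀) (h₀ : I₀ ⊆ I'') (h₀₁ : I₀ ⊆ I₁) (h₀₂ : I₀ ⊆ I₂) :
    FDistAdmissible (P₁.restrict h₀₁) (P₂.restrict h₀₂)
      (ℭ.restrict (I₁' := P₁.I' ∩ I₀) (I₂' := P₂.I' ∩ I₀) h₀ inter_subset_left inter_subset_left
        (fun _ ht ↦ ⟨(ℭ.dom₁_subset ht.1).1, ht.2⟩) (fun _ ht ↦ ⟨(ℭ.dom₂_subset ht.1).1, ht.2⟩))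
      (J ∩ I₀) r := by
  obtain ⟨hr, E, hEm, hEI, hJE, hE₁, hE₂, hvol, q, hq, hint⟩ := h
  have hsub : ∀ {t : ℝ}, t ∈ I₀ \ (E ∩ I₀) → t ∈ I'' \ E :=
    fun {t} ht ↦ ⟨h₀ ht.1, fun hE ↦ ht.2 ⟨hE, ht.1⟩⟩
  refine ⟨hr, E ∩ I₀, hEm.inter hI₀, inter_subset_right, ?_, ?_, ?_, ?_, ?_, ?_, ?_⟩
  · exact fun t ht ↦ ⟨ht.2, fun hE ↦ (hJE ht.1).2 hE.1⟩
  · exact fun t ht ↦ ⟨hE₁ (hsub ht), ht.1⟩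
  · exact fun t ht ↦ ⟨hE₂ (hsub ht), ht.1⟩
  · exact (measure_mono inter_subset_left).trans hvol
  · exact fun t ht ↦ q t (hsub ht)
  · exact fun t ht ↦ hq t (hsub ht)
  · intro s hs t ht hst
    exact hint s (hsub hs) t (hsub ht) hst

/-- **`d_𝔽` within the restricted correspondence is at most `d^{ℭ,J}_𝔽`.**
[cite: Bamler2023, §6.1, Def. 6.1] -/
theorem fDistWithin_restrict_le {I₀ : Set ℝ} (hI₀ : MeasurableSet I₀) (h₀ : I₀ ⊆ I'')
    (h₀₁ : I₀ ⊆ I₁) (h₀₂ : I₀ ⊆ I₂) :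
    fDistWithin (P₁.restrict h₀₁) (P₂.restrict h₀₂)
      (ℭ.restrict (I₁' := P₁.I' ∩ I₀) (I₂' := P₂.I' ∩ I₀) h₀ inter_subset_left inter_subset_left
        (fun _ ht ↦ ⟨(ℭ.dom₁_subset ht.1).1, ht.2⟩) (fun _ ht ↦ ⟨(ℭ.dom₂_subset ht.1).1, ht.2⟩))
      (J ∩ I₀) ≤ fDistWithin P₁ P₂ ℭ J :=
  le_fDistWithin_iff.2 fun _ hr ↦ fDistWithin_le (hr.restrict hI₀ h₀ h₀₁ h₀₂)

/-- **The `𝔽`-distance decreases under restriction to a measurable `I₀ ⊆ I`**: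
`d^{J ∩ I₀}_𝔽(𝒳¹|_{I₀}, 𝒳²|_{I₀}) ≤ d^{J}_𝔽(𝒳¹, 𝒳²)` (restrict the correspondences).
[cite: Bamler2023, §6.1, Def. 6.1; §5.1, Definition (F-distance)] -/
theorem fDist_restrict_le {I : Set ℝ} {J I₀ : Set ℝ} (hI₀ : MeasurableSet I₀) (h₀ : I₀ ⊆ I)
    (Q₁ Q₂ : MetricFlowPair.{u} I) :
    fDist (J ∩ I₀) (Q₁.restrict h₀) (Q₂.restrict h₀) ≤ fDist J Q₁ Q₂ := by
  refine le_iInf₂ fun ℭ hℭ ↦ ?_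
  refine (iInf₂_le (ℭ.restrict (I₁' := Q₁.I' ∩ I₀) (I₂' := Q₂.I' ∩ I₀) h₀ inter_subset_left
    inter_subset_left (fun _ ht ↦ ⟨(ℭ.dom₁_subset ht.1).1, ht.2⟩)
    (fun _ ht ↦ ⟨(ℭ.dom₂_subset ht.1).1, ht.2⟩)) ⟨?_, ?_⟩).trans
    (fDistWithin_restrict_le hI₀ h₀ h₀ h₀)
  · exact fun t ht ↦ ⟨hℭ.1 ht.1, ht.2⟩
  · exact fun t ht ↦ ⟨hℭ.2 ht.1, ht.2⟩

end MetricFlowPair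

end Literature.Geometry.Riemannian

end
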